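import Summits.HubbardSuperconductivity.HubbardSuperconductivity.Theorems.LevyLogBootstrapBlock2InfDivXXZKernelCovariance
import Literature.MathematicalPhysics.QuantumLattice.LiebMattisLadder
import HarnessLib

/-!
# Crux `Block2InfDivXXZ` (stmt-HubbardSuperconductivity-15048, route `LevyLogBootstrap`):
# symmetry of sector ground-state expectations under ALL graph automorphisms (any sector, any Δ)

Support lemma for every line of the crux (and for `LevyTransport`): all three crux idea cards
(`Cruxes/Block2InfDivXXZ/Ideas/*`) and the birth skeleton book-keep the block kernel MODE BY MODE on
the coarse torus, which presupposes that the raw transverse kernel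
`K_ψ(x, y) = ⟨ψ, S⁺_x S⁻_y ψ⟩` of a sector ground state `ψ` depends on `y - x` only. This file proves
it, in the generality in which it is true and cheap:

* `xxzHamiltonian_submatrix_comp` — for ANY graph automorphism `π` of ANY finite graph `G`, the
  relabelling of tensor indices `σ ↦ σ ∘ π` fixes `xxzHamiltonian n G J Δ` (the bond sum is permuted);
* `comp_mem_spinZSector` — relabelling preserves every magnetisation sector;
* `sectorGS_expect_submatrix_comp` — **symmetry of sector ground states**: for `G` connected, any real
  `Δ`, any sector value `m` and ANY vector `ψ` of the sector with
  `xxzHamiltonian 1 G (-1) Δ ψ = E_min(sector) ψ`, and any graph automorphism `π`,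
  `⟨ψ, A^π ψ⟩ = ⟨ψ, A ψ⟩` for every observable `A`, `A^π = A.submatrix (· ∘ π) (· ∘ π)` — because the
  relabelled vector is again a sector ground vector of the same norm, hence a unimodular multiple of
  `ψ` by Perron–Frobenius uniqueness (LANDED `xxz_sector_perronFrobenius`, route `PolyaSchurPairBoson`);
* `sectorGS_transverseCorr_comp` — hence `⟨ψ, S⁺_{π x} S⁻_{π y} ψ⟩ = ⟨ψ, S⁺_x S⁻_y ψ⟩`;
* `sectorGS_transverseCorr_compPerm` — on the torus `torusGraph 2 M`: invariance under coordinate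
  permutations (the torus translations and inversion are the landed `gs_expect_raiseLower_translate` /
  `gs_transverseKernel_neg` of `…KernelCovariance.lean`, which this file imports and generalises);
* `sectorGS_expect_autInvariant` — the registered `∀`-closed form of `sectorGS_expect_submatrix_comp`.

Sources: H. Tasaki, *Physics and Mathematics of Quantum Many-Body Systems* (2020) §2.1 (symmetry
of a unique ground state) and §2.4 (Perron–Frobenius in magnetisation sectors); T. Kennedy,
E. H. Lieb, B. S. Shastry, J. Stat. Phys. 53 (1988) 1019, p. 1021 (periodic boundary conditions,
translation-averaged two-point function). No definition is introduced; sorry-free. -/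

noncomputable section

set_option linter.dupNamespace false

namespace Summit.HubbardSuperconductivity.HubbardSuperconductivity.Theorems.LevyLogBootstrap

open scoped BigOperators Matrix ComplexOrder
open Matrix Finset Complex
open Literature.MathematicalPhysics.QuantumLattice Literature.Probability.LatticeModels
open Summit.AtomisticToContinuum.BoseEinsteinCondensation.Theorems.BECStronglyRayleighSectorPerron
open Summit.HubbardSuperconductivity.HubbardSuperconductivity.Theorems.PolyaSchurPairBoson

section Relabelling

variable {Λ : Type*} [Fintype Λ] [DecidableEq Λ]

/-- **The XXZ Hamiltonian is invariant under graph automorphisms**: if `π : Λ ≃ Λ` preserves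
adjacency of `G`, relabelling the tensor indices by `σ ↦ σ ∘ π` fixes
`xxzHamiltonian n G J Δ = J Σ_{{x,y} ∈ E(G)} (Sˣ_xSˣ_y + Sʸ_xSʸ_y + Δ Sᶻ_xSᶻ_y)` — the relabelled bond
operator of `{x, y}` is the bond operator of `{π x, π y}` (`spinBond_submatrix_comp`) and `Sym2.map π`
permutes the edge set. Tasaki (2020) §2.1; Kennedy–Lieb–Shastry (1988) p. 1021. [folklore] -/
theorem xxzHamiltonian_submatrix_comp (n : ℕ) (G : SimpleGraph Λ) [DecidableRel G.Adj] (J Δ : ℝ)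
    (π : Λ ≃ Λ) (hπ : ∀ x y, G.Adj (π x) (π y) ↔ G.Adj x y) :
    (xxzHamiltonian n G J Δ).submatrix (fun σ : TensorIndex Λ (n + 1) => σ ∘ π) (fun σ => σ ∘ π) =
      xxzHamiltonian n G J Δ := by
  simp only [xxzHamiltonian, submatrix_smul, Pi.smul_apply, submatrix_finset_sum]
  congr 1
  have hmem : ∀ (ρ : Λ ≃ Λ), (∀ x y, G.Adj (ρ x) (ρ y) ↔ G.Adj x y) →
      ∀ e ∈ G.edgeFinset, Sym2.map ρ e ∈ G.edgeFinset := by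
    intro ρ hρ e he
    induction e using Sym2.ind with
    | h x y =>
      rw [Sym2.map_mk, SimpleGraph.mem_edgeFinset, SimpleGraph.mem_edgeSet]
      rw [SimpleGraph.mem_edgeFinset, SimpleGraph.mem_edgeSet] at he
      exact (hρ x y).2 he
  have hπ' : ∀ x y, G.Adj (π.symm x) (π.symm y) ↔ G.Adj x y := fun x y => by
    conv_rhs => rw [← π.apply_symm_apply x, ← π.apply_symm_apply y]
    exact (hπ _ _).symm
  refine Finset.sum_nbij' (Sym2.map π) (Sym2.map π.symm) (hmem π hπ) (hmem π.symm hπ')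
    (fun e _ => ?_) (fun e _ => ?_) (fun e _ => ?_)
  · simp only [Sym2.map_map, Equiv.symm_comp_self, Sym2.map_id', id_eq]
  · simp only [Sym2.map_map, Equiv.self_comp_symm, Sym2.map_id', id_eq]
  · induction e using Sym2.ind with
    | h x y =>
      simp only [Sym2.map_mk, Sym2.lift_mk, submatrix_add, submatrix_smul, Pi.add_apply,
        Pi.smul_apply, spinBond_submatrix_comp]

/-- Relabelling the tensor indices by a site permutation preserves every magnetisation sector
(the magnetisation `Σ_x (n/2 - σ_x)` of a configuration is a symmetric function of the sites).
Tasaki (2020) §2.2, eq. (2.2.10). [folklore] -/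
theorem comp_mem_spinZSector {n : ℕ} (π : Λ ≃ Λ) {m : ℝ} {ψ : TensorIndex Λ (n + 1) → ℂ}
    (hψ : ψ ∈ spinZSector (Λ := Λ) n m) :
    (fun σ : TensorIndex Λ (n + 1) => ψ (σ ∘ π)) ∈ spinZSector (Λ := Λ) n m := by
  rw [LiebMattis.mem_spinZSector_iff] at hψ ⊢
  intro σ hσ
  rw [← hψ (σ ∘ π) hσ]
  simp only [Function.comp_apply]
  exact (Equiv.sum_comp π (fun x => ((n : ℂ) / 2 - ((σ x : ℕ) : ℂ)))).symm

/-- Expectations are quadratic: `⟨c ψ, A (c ψ)⟩ = |c|² ⟨ψ, A ψ⟩`. [folklore] -/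
theorem star_smul_dotProduct_mulVec_smul {ι : Type*} [Fintype ι] (c : ℂ) (A : Matrix ι ι ℂ)
    (ψ : ι → ℂ) :
    star (c • ψ) ⬝ᵥ (A *ᵥ (c • ψ)) = ((starRingEnd ℂ) c * c) * (star ψ ⬝ᵥ (A *ᵥ ψ)) := by
  rw [star_smul, mulVec_smul, smul_dotProduct, dotProduct_smul, smul_smul, smul_eq_mul,
    Complex.star_def]

end Relabelling

/-! ### Symmetry of sector ground states of the stoquastic XXZ Hamiltonian -/

section SectorGS

variable {Λ : Type*} [Fintype Λ] [DecidableEq Λ]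

/-- **Sector ground-state expectations are invariant under graph automorphisms.** Let `G` be a
connected finite graph, `Δ` real, `π` a graph automorphism of `G`, and `ψ` ANY vector of the
magnetisation sector `S^z_tot = m` with `xxzHamiltonian 1 G (-1) Δ ψ = E_min(m) ψ` (a sector ground
vector, possibly zero). Then `⟨ψ, A^π ψ⟩ = ⟨ψ, A ψ⟩` for every observable `A`,
`A^π = A.submatrix (· ∘ π) (· ∘ π)`. Proof: the relabelled vector `ψ^π` lies in the same sector
(`comp_mem_spinZSector`), satisfies the same eigen-equation (`xxzHamiltonian_submatrix_comp`,
`mulVec_comp_of_submatrix_eq`) and has the same norm; by Perron–Frobenius uniqueness in the sector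
(`xxz_sector_perronFrobenius`: the XY part is stoquastic and hop-connected for every real `Δ`)
`ψ^π = c ψ` with `|c| = 1`, so `⟨ψ, A^π ψ⟩ = ⟨ψ^π, A^π ψ^π⟩ = ⟨ψ, A ψ⟩` (reindexing).
Tasaki (2020) §2.1, §2.4. [folklore] -/
theorem sectorGS_expect_submatrix_comp (G : SimpleGraph Λ) [DecidableRel G.Adj] (hG : G.Connected)
    (Δ m : ℝ) (π : Λ ≃ Λ) (hπ : ∀ x y, G.Adj (π x) (π y) ↔ G.Adj x y)
    (ψ : TensorIndex Λ 2 → ℂ) (hψ : ψ ∈ spinZSector (Λ := Λ) 1 m)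
    (hH : xxzHamiltonian 1 G (-1) Δ *ᵥ ψ =
      ((lowestEnergyInSector 1 (xxzHamiltonian 1 G (-1) Δ) m : ℝ) : ℂ) • ψ)
    (A : Op Λ 2) :
    star ψ ⬝ᵥ (A.submatrix (fun σ : TensorIndex Λ 2 => σ ∘ π) (fun σ => σ ∘ π) *ᵥ ψ) =
      star ψ ⬝ᵥ (A *ᵥ ψ) := by
  by_cases hψ0 : ψ = 0
  · subst hψ0
    simp only [mulVec_zero, dotProduct_zero]
  -- a configuration in the support of `ψ`; its weight fixes the sector value `m`
  obtain ⟨σ₀, hσ₀⟩ : ∃ σ₀, ψ σ₀ ≠ 0 := Function.ne_iff.mp hψ0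
  obtain ⟨W, hW⟩ : ∃ W : ℕ, (∑ z, (σ₀ z : ℕ)) = W := ⟨_, rfl⟩
  have hmW : m = ((Fintype.card Λ * 1 : ℕ) : ℝ) / 2 - (W : ℝ) := by
    have h1 := (LiebMattis.mem_spinZSector_iff (Λ := Λ) 1 m ψ).1 hψ σ₀ hσ₀
    rw [LiebMattis.magnetisation_eq_sub_weight, hW] at h1
    have h2 : ((m : ℝ) : ℂ) = ((((Fintype.card Λ * 1 : ℕ) : ℝ) / 2 - (W : ℝ) : ℝ) : ℂ) := by
      rw [← h1]
      push_cast
      ring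
    exact_mod_cast h2
  subst hmW
  -- Perron–Frobenius uniqueness in the sector
  obtain ⟨-, huniq⟩ := xxz_sector_perronFrobenius G hG Δ W ⟨σ₀, hW⟩
  -- the relabelled vector is a sector ground vector
  set ψ' : TensorIndex Λ 2 → ℂ := fun σ => ψ (σ ∘ π) with hψ'def
  have hψ'K : ψ' ∈ spinZSector (Λ := Λ) 1 (((Fintype.card Λ * 1 : ℕ) : ℝ) / 2 - (W : ℝ)) :=
    comp_mem_spinZSector π hψ
  have hHinv := xxzHamiltonian_submatrix_comp 1 G (-1) Δ π hπ
  have hHψ' : xxzHamiltonian 1 G (-1) Δ *ᵥ ψ' =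
      ((lowestEnergyInSector 1 (xxzHamiltonian 1 G (-1) Δ)
        (((Fintype.card Λ * 1 : ℕ) : ℝ) / 2 - (W : ℝ)) : ℝ) : ℂ) • ψ' := by
    rw [hψ'def, mulVec_comp_of_submatrix_eq π hHinv ψ]
    funext σ
    rw [hH]
    rfl
  obtain ⟨c, hc⟩ := huniq ψ ψ' hψ hψ'K hH hHψ' hψ0
  -- `|c| = 1` from the norms
  have hnorm : star ψ' ⬝ᵥ ψ' = star ψ ⬝ᵥ ψ := star_comp_dotProduct_comp π ψ ψ
  have hcc : (starRingEnd ℂ) c * c = 1 := by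
    have h1 : star ψ' ⬝ᵥ ((1 : Op Λ 2) *ᵥ ψ') =
        ((starRingEnd ℂ) c * c) * (star ψ ⬝ᵥ ((1 : Op Λ 2) *ᵥ ψ)) := by
      rw [hc, star_smul_dotProduct_mulVec_smul]
    rw [one_mulVec, one_mulVec, hnorm] at h1
    have hne : star ψ ⬝ᵥ ψ ≠ 0 := (dotProduct_star_self_eq_zero (v := ψ)).not.mpr hψ0
    have h2 : ((starRingEnd ℂ) c * c) * (star ψ ⬝ᵥ ψ) = 1 * (star ψ ⬝ᵥ ψ) := by
      rw [one_mul]; exact h1.symm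
    exact mul_right_cancel₀ hne h2
  -- conclude by reindexing
  calc star ψ ⬝ᵥ (A.submatrix (fun σ : TensorIndex Λ 2 => σ ∘ π) (fun σ => σ ∘ π) *ᵥ ψ)
      = star ψ' ⬝ᵥ (A.submatrix (fun σ : TensorIndex Λ 2 => σ ∘ π) (fun σ => σ ∘ π) *ᵥ ψ') := by
        rw [hc, star_smul_dotProduct_mulVec_smul, hcc, one_mul]
    _ = star ψ ⬝ᵥ (A *ᵥ ψ) := expect_submatrix_comp π A ψ

/-- **The transverse kernel of a sector ground state is invariant under graph automorphisms**:
`⟨ψ, S⁺_{π x} S⁻_{π y} ψ⟩ = ⟨ψ, S⁺_x S⁻_y ψ⟩` for `G` connected, any real `Δ`, any sector value `m`,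
any sector ground vector `ψ` of `xxzHamiltonian 1 G (-1) Δ` and any graph automorphism `π`
(`sectorGS_expect_submatrix_comp` with `A = S⁺_x S⁻_y`, relabelled by `onSite_submatrix_comp`).
Tasaki (2020) §2.1, §2.4. [folklore] -/
theorem sectorGS_transverseCorr_comp (G : SimpleGraph Λ) [DecidableRel G.Adj] (hG : G.Connected)
    (Δ m : ℝ) (π : Λ ≃ Λ) (hπ : ∀ x y, G.Adj (π x) (π y) ↔ G.Adj x y)
    (ψ : TensorIndex Λ 2 → ℂ) (hψ : ψ ∈ spinZSector (Λ := Λ) 1 m)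
    (hH : xxzHamiltonian 1 G (-1) Δ *ᵥ ψ =
      ((lowestEnergyInSector 1 (xxzHamiltonian 1 G (-1) Δ) m : ℝ) : ℂ) • ψ)
    (x y : Λ) :
    star ψ ⬝ᵥ ((onSite (π x) (spinRaise 1) * onSite (π y) (spinLower 1)) *ᵥ ψ) =
      star ψ ⬝ᵥ ((onSite x (spinRaise 1) * onSite y (spinLower 1)) *ᵥ ψ) := by
  have hA : (onSite x (spinRaise 1) * onSite y (spinLower 1) : Op Λ 2).submatrix
        (fun σ : TensorIndex Λ 2 => σ ∘ π) (fun σ => σ ∘ π) =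
      onSite (π x) (spinRaise 1) * onSite (π y) (spinLower 1) := by
    rw [Matrix.submatrix_mul _ _ _ _ _ (bijective_comp_equiv (q := 2) π), onSite_submatrix_comp,
      onSite_submatrix_comp]
  rw [← hA]
  exact sectorGS_expect_submatrix_comp G hG Δ m π hπ ψ hψ hH _

end SectorGS

/-! ### The torus: coordinate permutations (the point group beyond translations/inversion) -/

section Torus

variable (M : ℕ) [NeZero M]

/-- **Point-group invariance of the transverse kernel of a sector ground state on the torus**:
for every permutation `s` of the coordinate axes (in `d = 2`: the swap `(x₀,x₁) ↦ (x₁,x₀)`),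
`⟨ψ, S⁺_{x∘s} S⁻_{y∘s} ψ⟩ = ⟨ψ, S⁺_x S⁻_y ψ⟩` for every sector ground vector `ψ` of `H_M(Δ)`, any
real `Δ`, any sector value `m` — coordinate permutations are automorphisms of the torus graph
(`torusGraph_adj_comp_perm`). With the landed translation/inversion covariance
(`gs_expect_raiseLower_translate`, `gs_transverseKernel_neg`) this gives the full `D₄ ⋉ (ℤ/M)²`
symmetry of the kernel (e.g. `K(e₁) = K(e₂)`), used to fold Lévy coefficients into mode classes and
to average bond correlations over directions. Kennedy–Lieb–Shastry (1988) p. 1021; Tasaki (2020)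
§2.1. [folklore] -/
theorem sectorGS_transverseCorr_compPerm (Δ m : ℝ) (s : Equiv.Perm (Fin 2))
    (ψ : TensorIndex (TorusSite 2 M) 2 → ℂ) (hψ : ψ ∈ spinZSector (Λ := TorusSite 2 M) 1 m)
    (hH : xxzHamiltonian 1 (torusGraph 2 M) (-1) Δ *ᵥ ψ =
      ((lowestEnergyInSector 1 (xxzHamiltonian 1 (torusGraph 2 M) (-1) Δ) m : ℝ) : ℂ) • ψ)
    (x y : TorusSite 2 M) :
    star ψ ⬝ᵥ ((onSite (x ∘ s) (spinRaise 1) * onSite (y ∘ s) (spinLower 1)) *ᵥ ψ) =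
      star ψ ⬝ᵥ ((onSite x (spinRaise 1) * onSite y (spinLower 1)) *ᵥ ψ) :=
  sectorGS_transverseCorr_comp (torusGraph 2 M) (torusGraph_connected 2 M) Δ m
    (Equiv.arrowCongr s.symm (Equiv.refl (ZMod M)))
    (fun a b => torusGraph_adj_comp_perm M s a b) ψ hψ hH x y

end Torus

/-- **Registered sub-goal `sectorGS_expect_autInvariant`** (support for the cruxes `Block2InfDivXXZ` /
`LevyTransport`): expectations of ANY sector ground vector of `xxzHamiltonian 1 G (-1) Δ` on a connected
finite graph are invariant under relabelling observables along ANY graph automorphism `π`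
(`⟨ψ, A^π ψ⟩ = ⟨ψ, A ψ⟩`; the `∀`-closed form of `sectorGS_expect_submatrix_comp`, covering
translations, inversion, coordinate permutations and reflections of the torus at once).
Perron–Frobenius uniqueness in the sector + covariance. Tasaki (2020) §2.1, §2.4. [folklore] -/
theorem sectorGS_expect_autInvariant :
    ∀ (Λ : Type) [Fintype Λ] [DecidableEq Λ] (G : SimpleGraph Λ) [DecidableRel G.Adj], G.Connected →
      ∀ (Δ m : ℝ) (π : Λ ≃ Λ), (∀ x y, G.Adj (π x) (π y) ↔ G.Adj x y) →
      ∀ (ψ : TensorIndex Λ 2 → ℂ), ψ ∈ @spinZSector Λ _ _ 1 m →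
      Matrix.mulVec (xxzHamiltonian 1 G (-1) Δ) ψ =
        ((lowestEnergyInSector 1 (xxzHamiltonian 1 G (-1) Δ) m : ℝ) : ℂ) • ψ →
      ∀ A : Op Λ 2,
        star ψ ⬝ᵥ Matrix.mulVec (A.submatrix (fun σ : TensorIndex Λ 2 => σ ∘ π) (fun σ => σ ∘ π)) ψ =
          star ψ ⬝ᵥ Matrix.mulVec A ψ :=
  fun _ _ _ G _ hG Δ m π hπ ψ hψ hH A =>
    sectorGS_expect_submatrix_comp G hG Δ m π hπ ψ hψ hH A

end Summit.HubbardSuperconductivity.HubbardSuperconductivity.Theorems.LevyLogBootstrap
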